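import Mathlib
import Literature.NumberTheory.GaussSums.PadicStationaryPhaseProofs
import Summits.ResolutionOfSingularities.ResolutionOfSingularities.Theorems.EquisingularLiftEquisingularLiftNatEquinodalJacobian

/-!
# (N9b) in scratch — «no other singular point in the residue tube» over ANY local ring (idea-3 g15, custody)

SCRATCH of record, NOT a proposal (custody seat). Offered as TEXT to the seat that files brick (N9b)
(res-L1-w45b-nose-w1 after (D6-4), or any prover the desk names). Nothing of the summit, of the crux
`EquisingularLiftNatThree`, or of any registered stub is proved here; counted 0; AI-written, weaker than
expert review; resolution of singularities in positive characteristic is NOT proved.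

Content (v2: the two folklore inputs are CITED from the tree, not re-proved — the square-zero Taylor
expansion for `MvPolynomial` is `Literature.NumberTheory.GaussSums.DabrowskiFisher1997.eval_add_of_mul_eq_zero`
and the symmetry of second partials is `…Equinodal.pderiv_pderiv_comm` ✓ p669724).
* `node_section_unique` — `O` any local ring, `g : MvPolynomial (Fin 3) O`, `n n' : Fin 3 → O` with
  `n' 2 = n 2`, `n' ≡ n (mod 𝔪)`, `∂₀ g`, `∂₁ g` vanishing at `n` and at `n'`, Hessian minor a unit at `n`
  ⟹ `n' = n`. Proof: `d = n' − n`, `I = (d 0, d 1) ≤ 𝔪`; Taylor in `O ⧸ I²` gives `Hessian · (d 0, d 1) = 0`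
  there, the unit determinant gives `d 0, d 1 ∈ I²`, so `I ≤ I • I ≤ 𝔪 • I` and Nakayama gives `I = ⊥`.
  No completeness, no separatedness, no Noetherian hypothesis.
* `node_section_unique'` — the chart form consuming the output shape of the tree theorem
  `Equinodal.exists_equinodal_lift` (✓ p670351).
-/

namespace NU4N9b

open MvPolynomial IsLocalRing
open Literature.NumberTheory.GaussSums (DabrowskiFisher1997.eval_add_of_mul_eq_zero)
open Summit.ResolutionOfSingularities.ResolutionOfSingularities.Cruxes.EquisingularLiftNat.Sections.Equinodal
  (pderiv_pderiv_comm)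


/-- Push `eval` through a ring hom: `φ (eval n P) = eval (φ ∘ n) (map φ P)`. -/
theorem ringHom_eval {R S : Type*} [CommRing R] [CommRing S] (φ : R →+* S) {σ : Type*}
    (n : σ → R) (P : MvPolynomial σ R) : φ (eval n P) = eval (φ ∘ n) (map φ P) := by
  rw [eval_map, ← eval₂_id, eval₂_comp_left, RingHom.comp_id]

/-- **(N9b) core.** Over ANY local ring: a second zero `n'` of `(∂₀ g, ∂₁ g)` in the same chart (`n' 2 = n 2`)
and in the residue tube of `n`, where the Hessian minor of `g` at `n` is a unit, equals `n`.
[Nakayama; no completeness] -/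
theorem node_section_unique {O : Type*} [CommRing O] [IsLocalRing O]
    (g : MvPolynomial (Fin 3) O) (n n' : Fin 3 → O)
    (h2 : n' 2 = n 2) (hres : ∀ j, residue O (n' j) = residue O (n j))
    (hn : ∀ j : Fin 2, eval n (pderiv (Fin.castSucc j) g) = 0)
    (hn' : ∀ j : Fin 2, eval n' (pderiv (Fin.castSucc j) g) = 0)
    (hhess : IsUnit (eval n (pderiv 0 (pderiv 0 g)) * eval n (pderiv 1 (pderiv 1 g))
      - eval n (pderiv 0 (pderiv 1 g)) ^ 2)) :
    n' = n := by
  classical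
  -- the difference and the ideal it generates
  set d : Fin 3 → O := n' - n with hd
  have hd2 : d 2 = 0 := by simp [hd, h2]
  have hdm : ∀ j, d j ∈ maximalIdeal O := by
    intro j
    have h0 : residue O (n' j - n j) = 0 := by rw [map_sub, hres j, sub_self]
    simpa [hd] using (IsLocalRing.residue_eq_zero_iff _).mp h0
  set I : Ideal O := Ideal.span {d 0, d 1} with hI
  have hdI : ∀ j, d j ∈ I := by
    intro j
    fin_cases j
    · exact Ideal.subset_span (by simp)
    · exact Ideal.subset_span (by simp)
    · simp [hd2]
  have hIm : I ≤ maximalIdeal O := by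
    rw [hI, Ideal.span_le]
    rintro a ha
    simp only [Set.mem_insert_iff, Set.mem_singleton_iff] at ha
    rcases ha with rfl | rfl
    · exact hdm 0
    · exact hdm 1
  -- work modulo I²
  set π : O →+* O ⧸ (I * I) := Ideal.Quotient.mk (I * I) with hπ
  have hππ : ∀ j k, π (d j) * π (d k) = 0 := by
    intro j k
    rw [← map_mul, hπ, Ideal.Quotient.eq_zero_iff_mem]
    exact Ideal.mul_mem_mul (hdI j) (hdI k)
  have hn'eq : (π ∘ n') = (π ∘ n) + (π ∘ d) := by
    funext j; simp [hd]
  -- Taylor for ∂ᵢ g, i = 0, 1, in O ⧸ I²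
  have key : ∀ i : Fin 2,
      ∑ j : Fin 3, π (eval n (pderiv j (pderiv (Fin.castSucc i) g))) * π (d j) = 0 := by
    intro i
    have hT := DabrowskiFisher1997.eval_add_of_mul_eq_zero (map π (pderiv (Fin.castSucc i) g))
      (π ∘ n) (π ∘ d) hππ
    rw [← hn'eq, ← ringHom_eval, ← ringHom_eval, hn' i, hn i, map_zero, zero_add] at hT
    simp_rw [pderiv_map, ← ringHom_eval, Function.comp_apply] at hT
    exact hT.symm
  -- the two linear equations  H · (π d0, π d1) = 0
  have hsum : ∀ f : Fin 3 → O ⧸ (I * I), ∑ j : Fin 3, f j * π (d j) = f 0 * π (d 0) + f 1 * π (d 1) := by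
    intro f
    rw [Fin.sum_univ_three, hd2, map_zero, mul_zero, add_zero]
  have e0 := key 0
  have e1 := key 1
  rw [hsum] at e0 e1
  simp only [Fin.castSucc_zero, Fin.castSucc_one] at e0 e1
  -- names for the Hessian entries
  set a := eval n (pderiv 0 (pderiv 0 g)) with ha
  set b := eval n (pderiv 0 (pderiv 1 g)) with hb
  set c := eval n (pderiv 1 (pderiv 1 g)) with hc
  have hb' : eval n (pderiv 1 (pderiv 0 g)) = b := by rw [hb, pderiv_pderiv_comm]
  rw [hb'] at e0
  -- e0 : π a * π d0 + π b * π d1 = 0 ;  e1 : π b * π d0 + π c * π d1 = 0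
  obtain ⟨u, hu⟩ := hhess
  -- D := a c - b² ;  d0 · D = c·(e0) - b·(e1),  d1 · D = a·(e1) - b·(e0)
  have hD0 : π (d 0) * π (a * c - b ^ 2) = 0 := by
    have : π (d 0) * π (a * c - b ^ 2)
        = π c * (π a * π (d 0) + π b * π (d 1)) - π b * (π b * π (d 0) + π c * π (d 1)) := by
      simp only [map_mul, map_sub, map_pow]; ring
    rw [this, e0, e1]; ring
  have hD1 : π (d 1) * π (a * c - b ^ 2) = 0 := by
    have : π (d 1) * π (a * c - b ^ 2)
        = π a * (π b * π (d 0) + π c * π (d 1)) - π b * (π a * π (d 0) + π b * π (d 1)) := by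
      simp only [map_mul, map_sub, map_pow]; ring
    rw [this, e0, e1]; ring
  have hunit : IsUnit (π (a * c - b ^ 2)) := by rw [← hu]; exact (u.map π.toMonoidHom).isUnit
  have hd0 : π (d 0) = 0 := (IsUnit.mul_left_eq_zero hunit).mp hD0
  have hd1 : π (d 1) = 0 := (IsUnit.mul_left_eq_zero hunit).mp hD1
  -- hence I ≤ I² and Nakayama
  have hmemII : ∀ x, π x = 0 → x ∈ I * I := by
    intro x hx
    rwa [hπ, Ideal.Quotient.eq_zero_iff_mem] at hx
  have hII : I ≤ I • I := by
    show Ideal.span {d 0, d 1} ≤ I • I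
    rw [Ideal.span_le]
    rintro x hx
    simp only [Set.mem_insert_iff, Set.mem_singleton_iff] at hx
    have hx' : π x = 0 := by rcases hx with rfl | rfl <;> assumption
    exact hmemII x hx'
  have hfg : (I : Submodule O O).FG := by
    show (Ideal.span {d 0, d 1}).FG
    exact Submodule.fg_span (Set.toFinite _)
  have hjac : I ≤ (⊥ : Ideal O).jacobson :=
    hIm.trans (IsLocalRing.maximalIdeal_le_jacobson _)
  have hI0 : I = ⊥ := Submodule.eq_bot_of_le_smul_of_le_jacobson_bot I I hfg hII hjac
  -- conclude
  have hdz : ∀ j, d j = 0 := by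
    intro j
    have := hdI j
    rw [hI0] at this
    simpa using this
  funext j
  have := hdz j
  simp only [hd, Pi.sub_apply, sub_eq_zero] at this
  exact this

/-- **(N9b), chart form.** With the node system at `n` in the shape output by the tree theorem
`Equinodal.exists_equinodal_lift` (chart `n 2 = 1`, `g(n) = 0`, `∇g(n) = 0`, Hessian minor a unit), any
`O`-point `n'` of `{∂₀ g = ∂₁ g = 0}` in the same chart reducing to the same residue point IS `n`. -/
theorem node_section_unique' {O : Type*} [CommRing O] [IsLocalRing O]
    (g : MvPolynomial (Fin 3) O) (n n' : Fin 3 → O)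
    (hchart : n 2 = 1) (hchart' : n' 2 = 1) (hres : ∀ j, residue O (n' j) = residue O (n j))
    (hnode : eval n g = 0 ∧ ∀ j, eval n (pderiv j g) = 0)
    (hn' : eval n' (pderiv 0 g) = 0 ∧ eval n' (pderiv 1 g) = 0)
    (hhess : IsUnit (eval n (pderiv 0 (pderiv 0 g)) * eval n (pderiv 1 (pderiv 1 g))
      - eval n (pderiv 0 (pderiv 1 g)) ^ 2)) :
    n' = n := by
  refine node_section_unique g n n' (hchart'.trans hchart.symm) hres ?_ ?_ hhess
  · intro j; exact hnode.2 _
  · intro j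
    fin_cases j
    · simpa using hn'.1
    · simpa using hn'.2

end NU4N9b
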